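import Summits.QuantumFields.YangMills.Theorems.UnitScaleTiltFluctuationComparisonRegPrLevelCauchy
import HarnessLib

/-!
# Route `UnitScaleTilt` — crux K1bR-pr `FluctuationComparisonRegPr` (stmt-QuantumFields-19201), S-E″ bookkeeping, part 4: THE KERNEL FORM — S-E″ from the
# WINDOW-CONDITIONED TRIVIAL-HISTORY ROWS ONLY (no `Adm`, no regions, no package)
# (support file `--supports stmt-QuantumFields-19201`)

Fleet lead `ym-ust-19201-p2` (gen 2, socket pen).  WHY.  Part 3's `cauchyAtHeights_of_twoRunLv` consumes the package rows `AdmOnSmall`, `TrivRegions`,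
`Regularity68`, `TermSize` (inside `TwoRunLv`) in their `Adm`-conditioned, all-histories form; ★pub-balaban3d-alpha-1 g2's finding F-α1-3 (fleet INBOX
2026-08-26T22:00Z) shows that for the lane's constructed datum (`Adm` := mass support, trivial mass floored at 1) the `Adm`-conditioned rows AT THE TRIVIAL
HISTORY over-reach (they would bound every datum), and recommends conditioning the trivial-history instances on the datum WINDOW `PlaqSmall (θ(K−j)) W`
instead.  S-E″ only ever uses the rows at the trivial history and on the window.  This file says so in the kernel: `cauchyAtHeights_of_trivRows` takes
EXACTLY (i) the (43)-decomposition of the trivial-history interaction sum, (ii) (68) for the trivial-history composite minimiser of a window-small datum,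
ALL fine plaquettes, (iii) the printed size (44) of the trivial-history terms of a window-small datum, (iv) `UminTrivIsRegMinimiser`, (v) the counting
clauses `LocCover`/`LocBlockVolume`, (vi) `PtermLipschitz`, `LocMatched`, `PolymerCauchyLvAt`, (vii) `MinimiserCauchyAt` — and nothing else; it is derived from
part 3 by RECASTING the datum (`trivData`: regions `:= univ`, admissibility `:=` the window, every history read at the trivial one), for which the package rows
ARE the window rows.  Whatever form the interface pen gives the rows next (F-α1-3 (a), F-α1-5), the 19201 consumer's obligation is this list.
WHAT THIS IS NOT: no estimate is asserted; `trivData` is a bookkeeping device (a datum with the same `Pterm/Loc/Umin/Pint` at the trivial history), not a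
construction of Bałaban's data.

References: C. King, CMP 102 (1986) 649–677 [King1986] (Thm 3.4 (3.9) p.656); T. Bałaban, CMP 102 (1985) 255–275 [Balaban1985UV3] ((43)–(44) pp.266–267,
(47) p.267, (68) p.273).
-/

noncomputable section

open MeasureTheory Filter Topology
open Literature.MathematicalPhysics.QuantumFieldTheory.Balaban1983to89
open Literature.MathematicalPhysics.QuantumFieldTheory.Balaban1983to89.T3ContinuumYM3Torus
open Literature.MathematicalPhysics.QuantumFieldTheory.Balaban1983to89.T3LevelShift
open Literature.MathematicalPhysics.QuantumFieldTheory.Balaban1983to89.T3UnitLawDensityEML (ℰp measurableE_ℰp)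
open Literature.MathematicalPhysics.QuantumFieldTheory.Balaban1983to89.T3UnitScaleTilt
open Literature.MathematicalPhysics.QuantumFieldTheory.Balaban1983to89.T3TiltDescent
open Literature.MathematicalPhysics.QuantumFieldTheory.Balaban1983to89.T3PrintedRegularMinimiser
open Literature.MathematicalPhysics.QuantumFieldTheory.Balaban1983to89.T3LogComparisonSocket
open Literature.MathematicalPhysics.QuantumFieldTheory.Balaban1983to89.T3AlphaInputsAC
open Literature.MathematicalPhysics.QuantumFieldTheory.Balaban1983to89.T3AlphaPolymerSocket
open Literature.MathematicalPhysics.QuantumFieldTheory.Balaban1983to89.T3AlphaInputsACTwoRun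
open Literature.MathematicalPhysics.QuantumFieldTheory.Balaban1983to89.T3AlphaInputsACTwoRunLevel
open Literature.MathematicalPhysics.QuantumFieldTheory.Balaban1983to89.B10Eq38TorusDomains (plaqsIn mem_plaqsIn_iff cornerSet toFine)
open Literature.MathematicalPhysics.QuantumFieldTheory.Balaban1983to89.B10Eq42TorusConstraint (lam42 lam42_self lam42_of_lt)
open Literature.MathematicalPhysics.QuantumFieldTheory.Balaban1983to89.Missing
open Summit.QuantumFields.YangMills.Theorems.LogComparisonLevelCauchy (cauchyAtHeights_of_twoRunLv)

namespace Summit.QuantumFields.YangMills.Theorems.LogComparisonLevelCauchyTriv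

variable {F : T3Family} {γ : ℝ} (D : AlphaDataT3 F γ) (b₀ p₀ : ℝ)

/-! ## §1 Recasting a datum at the trivial history -/

/-- **THE TRIVIAL-HISTORY RECAST OF A DATUM** (bookkeeping device): same histories, `triv`, `LF`, `mainT`, `Pterm`, `enl`, `treeLen`, `Zterm`, `χ`,
`Estep`, `Ecst`, `Rm`; regions `Ω := univ` (so `TrivRegions` holds and `Λ_j = univ`, `Λ_i = ∅` for `i < j`); admissibility `:=` the datum window
`PlaqSmall (θ(K−j)) W` (print's `χ_k`-support, (47) p.267 — so `AdmOnSmall` holds by definition); and `Umin`, `Pint`, `Loc` read at the TRIVIAL history for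
every history argument.  Its height readings `PintH/EcstH/RmH` are those of `D` (`rfl`). [cite: Balaban1985UV3, (47) p.267] -/
def trivData : AlphaDataT3 F γ where
  Hist := D.Hist
  triv := D.triv
  Ω := fun _ _ _ _ => Set.univ
  Adm := fun K j _ W => PlaqSmall (θBal F.L γ b₀ p₀ (K - j)) W
  LF := D.LF
  Umin := fun K j _ W => D.Umin K j (D.triv K j) W
  mainT := D.mainT
  Pint := fun K j _ W => D.Pint K j (D.triv K j) W
  Loc := fun K j _ i => D.Loc K j (D.triv K j) i
  Pterm := D.Pterm
  enl := D.enl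
  treeLen := D.treeLen
  Zterm := D.Zterm
  χ := D.χ
  Estep := D.Estep
  Ecst := D.Ecst
  Rm := D.Rm

/-- The recast has the same height reading of the interaction sum. [cite: Balaban1985UV3, (43) p.266] -/
theorem trivData_PintH : (trivData D b₀ p₀).PintH = D.PintH := rfl

/-- … hence the same cut-off-Cauchy property. [cite: King1986, Thm 3.4 (3.9) p.656] -/
theorem cauchyAtHeights_trivData_iff (m : ℕ) : CauchyAtHeights (trivData D b₀ p₀) b₀ p₀ m ↔ CauchyAtHeights D b₀ p₀ m := Iff.rfl

/-- The recast satisfies `TrivRegions`. [cite: Balaban1985UV3, (47) p.267] -/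
theorem trivRegions_trivData : TrivRegions (trivData D b₀ p₀) := fun _ _ _ => rfl

/-- The recast satisfies `AdmOnSmall` (its admissibility IS the window). [cite: Balaban1985UV3, (47) p.267] -/
theorem admOnSmall_trivData : AdmOnSmall (trivData D b₀ p₀) b₀ p₀ := fun _ _ _ _ h => h

variable {D b₀ p₀}

/-- `UminTrivIsRegMinimiser` passes to the recast (it only reads the trivial history). [cite: Balaban1985Variational, Thm 1 (8) p.279] -/
theorem uminTrivIsRegMinimiser_trivData {ε₀ : ℝ} (h : UminTrivIsRegMinimiser D b₀ p₀ ε₀) :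
    UminTrivIsRegMinimiser (trivData D b₀ p₀) b₀ p₀ ε₀ := h

/-- `LocMatched` passes to the recast. [cite: Balaban1985UV3, (24) p.262] -/
theorem locMatched_trivData (h : LocMatched D) : LocMatched (trivData D b₀ p₀) := h

/-- `LocCover` passes to the recast (its domains are `D`'s at the trivial history). [cite: Balaban1985UV3, (45) p.267] -/
theorem locCover_trivData {κ₁ C' : ℝ} (h : LocCover D κ₁ C') : LocCover (trivData D b₀ p₀) κ₁ C' :=
  ⟨h.1, fun K j _ i y => h.2 K j (D.triv K j) i y⟩

/-- `LocBlockVolume` passes to the recast. [cite: Balaban1985UV3, (24) p.262] -/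
theorem locBlockVolume_trivData (h : LocBlockVolume D) : LocBlockVolume (trivData D b₀ p₀) :=
  fun K j _ i Y hY => h K j (D.triv K j) i Y hY

/-- `PtermLipschitz` passes to the recast (same `Pterm`, `enl`, `treeLen`). [cite: Balaban1987RG1, (1.18) p.263] -/
theorem ptermLipschitz_trivData {CL κ₁ α₁ t₀ : ℝ} (h : PtermLipschitz D CL κ₁ α₁ t₀) : PtermLipschitz (trivData D b₀ p₀) CL κ₁ α₁ t₀ := h

/-- `PolymerCauchyLvAt` passes to the recast. [cite: King1986, Prop. 3.9 (3.73)-(3.74) p.665] -/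
theorem polymerCauchyLvAt_trivData {C68 κ₁ a C : ℝ} (h : PolymerCauchyLvAt D b₀ p₀ C68 κ₁ a C) :
    PolymerCauchyLvAt (trivData D b₀ p₀) b₀ p₀ C68 κ₁ a C := h

/-- **(43) AT THE TRIVIAL HISTORY ⇒ `PintDecomp` of the recast.** [cite: Balaban1985UV3, (43) p.266] -/
theorem pintDecomp_trivData
    (h : ∀ (K j : ℕ) (W : GaugeField (F.P K) j (Matrix.specialUnitaryGroup (Fin 2) ℂ)),
      D.Pint K j (D.triv K j) W = ∑ i ∈ Finset.Icc 1 j, ∑ Y ∈ D.Loc K j (D.triv K j) i, D.Pterm K i Y (D.Umin K j (D.triv K j) W)) :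
    PintDecomp (trivData D b₀ p₀) := fun K j _ W => h K j W

/-- **(68) FOR THE TRIVIAL-HISTORY MINIMISER OF A WINDOW-SMALL DATUM, ALL PLAQUETTES ⇒ `Regularity68` of the recast** (regions: `Λ_j = univ`, `Λ_i = ∅`
for `i < j` — a plaquette has a corner). [cite: Balaban1985UV3, (68) p.273] -/
theorem regularity68_trivData {C68 : ℝ}
    (h : ∀ (K j : ℕ) (W : GaugeField (F.P K) j (Matrix.specialUnitaryGroup (Fin 2) ℂ)), j ≤ K →
      PlaqSmall (θBal F.L γ b₀ p₀ (K - j)) W → ∀ q : Plaq (F.P K) 0,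
        GaugeGroup.dist1 (GaugeField.plaqHol (D.Umin K j (D.triv K j) W) q) ≤ C68 * θBal F.L γ b₀ p₀ (K - j) * (((F.L : ℝ) ^ j)⁻¹) ^ 2) :
    Regularity68 (trivData D b₀ p₀) b₀ p₀ C68 := by
  intro K j hh W hj hadm i hi q hq
  rcases hi.lt_or_eq with hlt | rfl
  · -- `i < j`: the region `Λ_i = univ ∖ univ` is empty, no plaquette has its corners there
    exfalso
    rw [mem_plaqsIn_iff] at hq
    have hΛ : (trivData D b₀ p₀).Λ K j hh i = (∅ : Set (Site (F.P K) 0)) := by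
      show lam42 (fun _ => (Set.univ : Set (Site (F.P K) 0))) j i = ∅
      rw [lam42_of_lt hlt, Set.sdiff_self]
    rw [hΛ] at hq
    exact hq (Set.mem_insert _ _)
  · exact h K i W hj hadm q

/-- **THE PRINTED SIZE (44) OF THE TRIVIAL-HISTORY TERMS OF A WINDOW-SMALL DATUM ⇒ `TermSize` of the recast.** [cite: Balaban1985UV3, (44) p.267] -/
theorem termSize_trivData {C κ₁ : ℝ} (hκ : 0 < κ₁)
    (h : ∀ (K j : ℕ) (W : GaugeField (F.P K) j (Matrix.specialUnitaryGroup (Fin 2) ℂ)), j ≤ K →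
      PlaqSmall (θBal F.L γ b₀ p₀ (K - j)) W → ∀ i, 1 ≤ i → i ≤ j → ∀ Y ∈ D.Loc K j (D.triv K j) i,
        |D.Pterm K i Y (D.Umin K j (D.triv K j) W)| ≤
          C * Real.exp (-κ₁ * D.treeLen K i Y) * θBal F.L γ b₀ p₀ (K - j + 1) ^ 2 * (((F.L : ℝ) ^ (j - i))⁻¹) ^ 4) :
    TermSize (trivData D b₀ p₀) b₀ p₀ C κ₁ :=
  ⟨hκ, fun K j _ W hj hadm i hi1 hij Y hY => h K j W hj hadm i hi1 hij Y hY⟩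

/-! ## §2 S-E″ in kernel form -/

/-- **S-E″ FROM THE WINDOW-CONDITIONED TRIVIAL-HISTORY ROWS ONLY** (threshold-free; `1 < L`, `0 < γ ≤ 1`, `0 < b₀`, `0 < p₀`, `0 < a`, `0 < a₁`,
`m > (3+b)/b`, `b = min(a,a₁,1)`): the (43)-decomposition at the trivial history, (68) for the trivial-history composite minimiser of every window-small datum
(all fine plaquettes), the printed size (44) of the trivial-history terms of window-small data, `UminTrivIsRegMinimiser`, the counting clauses `LocCover`,
`LocBlockVolume`, the two-run clauses `PtermLipschitz`, `LocMatched`, `PolymerCauchyLvAt` at one decay rate `κ₁`, and `MinimiserCauchyAt` give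
`CauchyAtHeights D b₀ p₀ m` — part 3's `cauchyAtHeights_of_twoRunLv` applied to the recast `trivData D b₀ p₀`.  No `Adm`, no regions, no size bundle, no
representation clause is consumed. [cite: King1986, Thm 3.4 (3.9) p.656] -/
theorem cauchyAtHeights_of_trivRows {ε₀ a a₁ C68 κ₁ C C' CL α₁ t₀ Cp : ℝ} {m : ℕ}
    (hL : 1 < F.L) (hγ : 0 < γ) (hγ1 : γ ≤ 1) (hb : 0 < b₀) (hp : 0 < p₀) (ha : 0 < a) (ha₁ : 0 < a₁)
    (hm : (3 + min (min a a₁) 1) / min (min a a₁) 1 < (m : ℝ))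
    (hMC : MinimiserCauchyAt F γ ε₀ b₀ p₀ a₁)
    (hdec : ∀ (K j : ℕ) (W : GaugeField (F.P K) j (Matrix.specialUnitaryGroup (Fin 2) ℂ)),
      D.Pint K j (D.triv K j) W = ∑ i ∈ Finset.Icc 1 j, ∑ Y ∈ D.Loc K j (D.triv K j) i, D.Pterm K i Y (D.Umin K j (D.triv K j) W))
    (hUmin : UminTrivIsRegMinimiser D b₀ p₀ ε₀)
    (h68 : ∀ (K j : ℕ) (W : GaugeField (F.P K) j (Matrix.specialUnitaryGroup (Fin 2) ℂ)), j ≤ K →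
      PlaqSmall (θBal F.L γ b₀ p₀ (K - j)) W → ∀ q : Plaq (F.P K) 0,
        GaugeGroup.dist1 (GaugeField.plaqHol (D.Umin K j (D.triv K j) W) q) ≤ C68 * θBal F.L γ b₀ p₀ (K - j) * (((F.L : ℝ) ^ j)⁻¹) ^ 2)
    (hκ : 0 < κ₁)
    (hTS : ∀ (K j : ℕ) (W : GaugeField (F.P K) j (Matrix.specialUnitaryGroup (Fin 2) ℂ)), j ≤ K →
      PlaqSmall (θBal F.L γ b₀ p₀ (K - j)) W → ∀ i, 1 ≤ i → i ≤ j → ∀ Y ∈ D.Loc K j (D.triv K j) i,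
        |D.Pterm K i Y (D.Umin K j (D.triv K j) W)| ≤
          C * Real.exp (-κ₁ * D.treeLen K i Y) * θBal F.L γ b₀ p₀ (K - j + 1) ^ 2 * (((F.L : ℝ) ^ (j - i))⁻¹) ^ 4)
    (hLC : LocCover D κ₁ C') (hBV : LocBlockVolume D) (ht₀ : 0 < t₀) (hLip : PtermLipschitz D CL κ₁ α₁ t₀) (hLM : LocMatched D)
    (hLv : PolymerCauchyLvAt D b₀ p₀ C68 κ₁ a Cp) :
    CauchyAtHeights D b₀ p₀ m := by
  have hTR : TwoRunLv (trivData D b₀ p₀) b₀ p₀ C68 a :=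
    ⟨κ₁, ⟨C, termSize_trivData hκ hTS⟩, ⟨C', locCover_trivData hLC⟩, locBlockVolume_trivData hBV,
      ⟨CL, α₁, t₀, ht₀, ptermLipschitz_trivData hLip⟩, locMatched_trivData hLM, ⟨Cp, polymerCauchyLvAt_trivData hLv⟩⟩
  exact (cauchyAtHeights_trivData_iff D b₀ p₀ m).mp
    (cauchyAtHeights_of_twoRunLv (trivData D b₀ p₀) hL hγ hγ1 hb hp ha ha₁ hm hMC (pintDecomp_trivData hdec)
      (admOnSmall_trivData D b₀ p₀) (uminTrivIsRegMinimiser_trivData hUmin) (trivRegions_trivData D b₀ p₀) (regularity68_trivData h68) hTR)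

end Summit.QuantumFields.YangMills.Theorems.LogComparisonLevelCauchyTriv

end
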